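import Summits.QuantumFields.YangMills.Theorems.ConvexGribovBodyBrascampLiebVacuumSCCubeWitnessOfDimensionGap
import Mathlib.Analysis.Normed.Algebra.MatrixExponential
import Mathlib.Analysis.SpecialFunctions.Exponential

/-!
# Crux `BrascampLiebVacuumSC` (stmt-QuantumFields-16404), line `SketchIdeator1`, skeleton v7:
# stub `stub_expLocal` — local bi-Lipschitz of the matrix exponential and rigidity of near-involutions

Pure matrix analysis, consumed verbatim by `stub_gapAssembly`:

* (A) `exp = NormedSpace.exp` is bi-Lipschitz with constants `2` on a small Frobenius ball around `0`:
  for `froSq X, froSq Y < r₀²`, `froSq (X − Y) ≤ 4 froSq (e^X − e^Y)` and `froSq (e^X − e^Y) ≤ 4 froSq (X − Y)`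
  (strict differentiability of `exp` at `0` with derivative `1`, `hasStrictFDerivAt_exp_zero`, in the
  Frobenius normed algebra `Matrix (Fin N) (Fin N) ℂ`);
* (B) rigidity: if `P² = 1`, `P` unitary, `froSq X < r₀²` and `(P e^X)² = 1` then `P X P = −X`
  (`e^{P X P} = P e^X P = (e^X)⁻¹ = e^{−X}` and injectivity of `exp` on the ball, from (A)).
-/

set_option autoImplicit false

open scoped BigOperators Topology Matrix
open Filter
open Literature.MathematicalPhysics.QuantumFieldTheory
open Summit.QuantumFields.YangMills.Cruxes.CovarianceBound.SupportWindow (froSq)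

noncomputable section

namespace Summit.QuantumFields.YangMills.Theorems.BrascampLiebVacuumSC

namespace ExpLocal

section Frobenius

open scoped Matrix.Norms.Frobenius
open Summit.QuantumFields.YangMills.Cruxes.CovarianceBound.SupportWindow.SupMeasurable
  (froSq_eq_norm_sq froSq_nonneg)

set_option backward.isDefEq.respectTransparency false in
/-- Strict differentiability of `exp` at `0` (derivative `1`), unfolded with constant `1/2` on a Frobenius
ball: `‖e^X − e^Y − (X − Y)‖ ≤ ½ ‖X − Y‖` for `‖X‖, ‖Y‖ < r₀`. (The `exp` of `hasStrictFDerivAt_exp_zero`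
carries the Frobenius-normed-ring instances, the statement the bare matrix ones; they agree up to unfolding.)
[folklore] -/
theorem exists_ball_exp_sub_sub_le (N : ℕ) :
    ∃ r₀ : ℝ, 0 < r₀ ∧ ∀ X Y : Matrix (Fin N) (Fin N) ℂ, ‖X‖ < r₀ → ‖Y‖ < r₀ →
      ‖NormedSpace.exp X - NormedSpace.exp Y - (X - Y)‖ ≤ 1 / 2 * ‖X - Y‖ := by
  have h := ((hasStrictFDerivAt_exp_zero (𝕂 := ℂ) (𝔸 := Matrix (Fin N) (Fin N) ℂ)).isLittleO.def
    (by norm_num : (0 : ℝ) < 1 / 2))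
  rw [Metric.eventually_nhds_iff_ball] at h
  obtain ⟨ε, hε, hball⟩ := h
  refine ⟨ε, hε, fun X Y hX hY => ?_⟩
  have hmem : (X, Y) ∈ Metric.ball ((0 : Matrix (Fin N) (Fin N) ℂ), (0 : Matrix (Fin N) (Fin N) ℂ)) ε := by
    rw [← ball_prod_same]
    exact Set.mk_mem_prod (mem_ball_zero_iff.2 hX) (mem_ball_zero_iff.2 hY)
  simpa using hball _ hmem

/-- Part (A) in norm form: on a small Frobenius ball, `‖X − Y‖ ≤ 2 ‖e^X − e^Y‖` and
`‖e^X − e^Y‖ ≤ 2 ‖X − Y‖`. [folklore] -/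
theorem exists_ball_exp_bilipschitz (N : ℕ) :
    ∃ r₀ : ℝ, 0 < r₀ ∧ ∀ X Y : Matrix (Fin N) (Fin N) ℂ, ‖X‖ < r₀ → ‖Y‖ < r₀ →
      ‖X - Y‖ ≤ 2 * ‖NormedSpace.exp X - NormedSpace.exp Y‖ ∧
      ‖NormedSpace.exp X - NormedSpace.exp Y‖ ≤ 2 * ‖X - Y‖ := by
  obtain ⟨r₀, hr₀, h⟩ := exists_ball_exp_sub_sub_le N
  refine ⟨r₀, hr₀, fun X Y hX hY => ?_⟩
  have h1 := h X Y hX hY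
  have h2 : ‖NormedSpace.exp X - NormedSpace.exp Y‖ - ‖X - Y‖ ≤
      ‖NormedSpace.exp X - NormedSpace.exp Y - (X - Y)‖ := norm_sub_norm_le _ _
  have h3 : ‖X - Y‖ - ‖NormedSpace.exp X - NormedSpace.exp Y‖ ≤
      ‖NormedSpace.exp X - NormedSpace.exp Y - (X - Y)‖ := by
    rw [← norm_sub_rev (X - Y)]; exact norm_sub_norm_le _ _
  have h4 := norm_nonneg (X - Y)
  constructor <;> linarith

/-- Part (A) in `froSq` form: for `froSq X, froSq Y < r₀²`, `froSq (X − Y) ≤ 4 froSq (e^X − e^Y)` and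
`froSq (e^X − e^Y) ≤ 4 froSq (X − Y)`. [folklore] -/
theorem exists_ball_froSq_exp_bilipschitz (N : ℕ) :
    ∃ r₀ : ℝ, 0 < r₀ ∧ ∀ X Y : Matrix (Fin N) (Fin N) ℂ, froSq X < r₀ ^ 2 → froSq Y < r₀ ^ 2 →
      froSq (X - Y) ≤ 4 * froSq (NormedSpace.exp X - NormedSpace.exp Y) ∧
      froSq (NormedSpace.exp X - NormedSpace.exp Y) ≤ 4 * froSq (X - Y) := by
  obtain ⟨r₀, hr₀, h⟩ := exists_ball_exp_bilipschitz N
  refine ⟨r₀, hr₀, fun X Y hX hY => ?_⟩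
  have hX' : ‖X‖ < r₀ := lt_of_pow_lt_pow_left₀ 2 hr₀.le (by rwa [← froSq_eq_norm_sq])
  have hY' : ‖Y‖ < r₀ := lt_of_pow_lt_pow_left₀ 2 hr₀.le (by rwa [← froSq_eq_norm_sq])
  obtain ⟨h1, h2⟩ := h X Y hX' hY'
  rw [froSq_eq_norm_sq, froSq_eq_norm_sq]
  have h4 := norm_nonneg (X - Y)
  have h5 := norm_nonneg (NormedSpace.exp X - NormedSpace.exp Y)
  constructor <;> nlinarith

/-- `froSq M = 0` forces `M = 0`. [folklore] -/
theorem eq_zero_of_froSq_eq_zero {N : ℕ} {M : Matrix (Fin N) (Fin N) ℂ} (h : froSq M = 0) : M = 0 := by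
  rw [froSq_eq_norm_sq] at h
  exact norm_eq_zero.1 (pow_eq_zero_iff two_ne_zero |>.1 h)

end Frobenius

/-- Part (B), rigidity of near-involutions, from part (A) at the same radius: if `P² = 1`, `P` unitary,
`froSq X < r₀²` and `(P e^X)² = 1` then `P X P = −X`. Indeed `e^{P X P} = P e^X P⁻¹ = P e^X P`
(`Matrix.exp_conj`), the hypothesis says `e^{P X P} e^X = 1`, so `e^{P X P} = (e^X)⁻¹ = e^{−X}`
(`Matrix.exp_neg`); both `P X P` and `−X` lie in the `r₀`-ball (unitary invariance of `froSq`), and the lower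
bi-Lipschitz bound gives `froSq (P X P + X) ≤ 0`. [folklore] -/
theorem rigidity_of_bilipschitz {N : ℕ} {r₀ : ℝ}
    (hA : ∀ X Y : Matrix (Fin N) (Fin N) ℂ, froSq X < r₀ ^ 2 → froSq Y < r₀ ^ 2 →
      froSq (X - Y) ≤ 4 * froSq (NormedSpace.exp X - NormedSpace.exp Y) ∧
      froSq (NormedSpace.exp X - NormedSpace.exp Y) ≤ 4 * froSq (X - Y))
    (P X : Matrix (Fin N) (Fin N) ℂ) (hPP : P * P = 1) (hPU : P ∈ Matrix.unitaryGroup (Fin N) ℂ)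
    (hX : froSq X < r₀ ^ 2) (h1 : P * NormedSpace.exp X * (P * NormedSpace.exp X) = 1) :
    P * X * P = -X := by
  have hPinv : P⁻¹ = P := Matrix.inv_eq_left_inv hPP
  have hPunit : IsUnit P := ⟨⟨P, P, hPP, hPP⟩, rfl⟩
  have hconj : NormedSpace.exp (P * X * P) = P * NormedSpace.exp X * P := by
    have := Matrix.exp_conj P X hPunit
    rwa [hPinv] at this
  have hprod : NormedSpace.exp (P * X * P) * NormedSpace.exp X = 1 := by
    rw [hconj, Matrix.mul_assoc]; exact h1
  have hexp : NormedSpace.exp (P * X * P) = NormedSpace.exp (-X) := by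
    rw [Matrix.exp_neg]; exact (Matrix.inv_eq_left_inv hprod).symm
  have hA1 : froSq (P * X * P) < r₀ ^ 2 := by
    rwa [DimensionGap.froSq_mul_unitary _ hPU, GaugeAlgebra.froSq_unitary_mul hPU]
  have hA2 : froSq (-X) < r₀ ^ 2 := by rwa [DimensionGap.froSq_neg]
  have hle := (hA _ _ hA1 hA2).1
  rw [hexp, sub_self] at hle
  have h0 : froSq (0 : Matrix (Fin N) (Fin N) ℂ) = 0 := by simp [froSq]
  rw [h0, mul_zero, sub_neg_eq_add] at hle
  have hz : P * X * P + X = 0 := ExpLocal.eq_zero_of_froSq_eq_zero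
    (le_antisymm hle (Cruxes.CovarianceBound.SupportWindow.SupMeasurable.froSq_nonneg _))
  exact eq_neg_of_add_eq_zero_left hz

end ExpLocal

/-- **Stub `stub_expLocal` (matrix analysis).** For every `N` there is `r₀ > 0` such that
(A) the matrix exponential is bi-Lipschitz with constants `2` on the Frobenius ball `froSq < r₀²`:
`froSq (X − Y) ≤ 4 froSq (e^X − e^Y)` and `froSq (e^X − e^Y) ≤ 4 froSq (X − Y)` (strict differentiability of
`exp` at `0`), and (B) near-involutions are rigid: `P² = 1`, `P` unitary, `froSq X < r₀²`, `(P e^X)² = 1`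
imply `P X P = −X` (conjugation invariance of `exp`, `e^{−X} = (e^X)⁻¹`, injectivity of `exp` on the ball).
[folklore] -/
theorem stub_expLocal :
    ∀ N : ℕ, ∃ r₀ : ℝ, 0 < r₀ ∧
      (∀ X Y : Matrix (Fin N) (Fin N) ℂ, froSq X < r₀ ^ 2 → froSq Y < r₀ ^ 2 →
        froSq (X - Y) ≤ 4 * froSq (NormedSpace.exp X - NormedSpace.exp Y) ∧
        froSq (NormedSpace.exp X - NormedSpace.exp Y) ≤ 4 * froSq (X - Y)) ∧
      (∀ P X : Matrix (Fin N) (Fin N) ℂ, P * P = 1 → P ∈ Matrix.unitaryGroup (Fin N) ℂ →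
        froSq X < r₀ ^ 2 → P * NormedSpace.exp X * (P * NormedSpace.exp X) = 1 →
        P * X * P = -X) := by
  intro N
  obtain ⟨r₀, hr₀, hA⟩ := ExpLocal.exists_ball_froSq_exp_bilipschitz N
  exact ⟨r₀, hr₀, hA, fun P X hPP hPU hX h1 => ExpLocal.rigidity_of_bilipschitz hA P X hPP hPU hX h1⟩

end Summit.QuantumFields.YangMills.Theorems.BrascampLiebVacuumSC

end
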